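import Mathlib
import HarnessLib
import Summits.Ventures.LatticeQCDFlow.Exactness.ThermodynamicIntegration

/-!
# The quasi-static floor to second order: `KL_qs(n) = (⟨D⟩₀ − ⟨D⟩₁)/(2n) + O(n⁻²)`, certified

HONEST FRAMING: exact (Metropolis-corrected) sampling algorithms for lattice gauge theory;
figures of merit are autocorrelation/cost numbers at stated couplings and volumes; no
continuum-physics claim.

Venture `LatticeQCDFlow` (cell pub-lqcd), topic `Exactness`, FANOUT row 8 (s0-cpn-nemc, GEN-4).
OUR WORK (elementary), nothing cited as a fact; the two real-analysis lemmas (right half of the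
Hermite–Hadamard inequality, trapezoid-rule error bound) are `[folklore]` and proved here from
Mathlib (`convexOn_of_hasDerivWithinAt2_nonneg`, `intervalIntegral.integral_mono_on`).

`Exactness/QuasiStaticDissipation.lean` (row 8 GEN-2/3) typed the quasi-static dissipation of
the stepwise linear switching protocol `c_k = k/n` of Bonanno–Nada–Vadacchino 2024 (2-d CP(N−1)
NE-MCMC, OBC → PBC) and of the cell's 4-d defect flows, `KL_qs(n) = Σ_k [(c_{k+1} − c_k)⟨D⟩_{c_k}
− (F(c_{k+1}) − F(c_k))]`, with the first-order sandwich `0 ≤ KL_qs(n) ≤ (⟨D⟩_0 − ⟨D⟩_1)/n`, and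
said in its docstring that the SECOND-ORDER statement — the number actually used as the 'floor'
in HOME/s0-cpn-nemc/RESULTS.md §7(c)/§8, `KL_qs = (⟨D⟩_0 − ⟨D⟩_1)/(2 n_step) = 12.35·L_d/n_step`
— "needs `d⟨D⟩_c/dc = −Var_c D` and is not typed".  It is typed here:

* `qsDissipation_uniform_eq` — exact decomposition `KL_qs(n) = (⟨D⟩_0 − ⟨D⟩_1)/(2n) +
  Σ_{k<n} defect[k/n, (k+1)/n]`, where `defect[a,b] = (b − a)(⟨D⟩_a + ⟨D⟩_b)/2 − (F b − F a)`
  (`trapDefect`) is the error of the trapezoid rule for `∫_a^b ⟨D⟩_c dc = F b − F a`;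
* `abs_trapDefect_le` — `|defect[a,b]| ≤ M(b − a)³/12` when `|κ₃,c(D)| ≤ M` on `[a,b]`
  (`κ₃ = d²⟨D⟩_c/dc²`, file `ThermodynamicIntegration`), from the generic
  `abs_trapezoid_sub_le` (Hermite–Hadamard applied to the convex `f + (M/2)t²` and the concave
  `f − (M/2)t²`); signed versions `trapDefect_nonneg_of_kappa3D_nonneg` / `_nonpos_of_…_nonpos`;
* **`abs_qsDissipation_uniform_sub_floor_le`** — `|KL_qs(n) − (⟨D⟩_0 − ⟨D⟩_1)/(2n)| ≤ M/(12n²)`: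
  the floor IS the quasi-static cost up to a certified `O(n⁻²)`;
* `floor_le_qsDissipation_uniform` / `qsDissipation_uniform_le_floor` — if the switch observable
  is positively (negatively) skewed along the whole path, the floor is a true lower (upper) bound;
* `abs_qsDissipation_uniform_sub_floor_le_of_bounded` — unconditionally, for `|D| ≤ B`,
  `|KL_qs(n) − (⟨D⟩_0 − ⟨D⟩_1)/(2n)| ≤ 2B³/(3n²)`.

Dictionary / numbers (OURS, RESULTS §7(c)/§8; not proved here).  At (N, β, L, L_d) = (21, 0.7,
114, 24): `⟨D⟩_0 − ⟨D⟩_1 = 24.70·L_d = 593`, floor `0.2965` at `n_step = 1000`; the measured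
`Var_c(D)` scan gives `sup_c|κ₃| ≳ 5·10³` (secant lower bound; `κ₃ < 0` for `c ≲ 0.25`, `> 0`
above, so neither signed version applies globally — only the two-sided bound does); with
`M = 10⁴` the certified remainder is `≤ 8·10⁻⁴ = 0.3 %` of the floor, and its Euler–Maclaurin
value `(Var_0 − Var_1)/(12 n²) = 6·10⁻⁵`.  Hence the 6–29 % EXCESS of the measured `D_KL` over the
floor in all 15 composite cells of the S0-D2 reproduction (and the 0–18 % excess of the 45 published
N = 21 points, RESULTS §8(b)) is finite-rate (lag) dissipation of the dynamics, not a property of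
the quasi-static limit — the statement RESULTS §8(f)(iv) uses.  What is NOT claimed: that an
under-relaxed protocol dissipates more than `KL_qs` (a statement about the Markov dynamics).
-/

namespace Summit.Ventures.LatticeQCDFlow.Exactness

open Finset Set MeasureTheory intervalIntegral

variable {X : Type*} [Fintype X]

/-! ## Two lemmas of real analysis: Hermite–Hadamard and the trapezoid error -/

/-- **Hermite–Hadamard, right half, in primitive form.**  If `f` is continuous, convex on
`[a, b]`, and `Φ' = f`, then `Φ b − Φ a = ∫_a^b f ≤ (b − a)(f a + f b)/2` (symmetrise the
integrand: `f t + f (a + b − t) ≤ f a + f b`). [folklore] -/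
theorem sub_le_trapezoid_of_convexOn {f Φ : ℝ → ℝ} {a b : ℝ} (hab : a ≤ b) (hf : Continuous f)
    (hconv : ConvexOn ℝ (Icc a b) f) (hΦ : ∀ t, HasDerivAt Φ (f t) t) :
    Φ b - Φ a ≤ (b - a) * (f a + f b) / 2 := by
  have hint : ∫ t in a..b, f t = Φ b - Φ a :=
    integral_eq_sub_of_hasDerivAt (fun t _ => hΦ t) (hf.intervalIntegrable a b)
  have hsym : ∫ t in a..b, f (a + b - t) = ∫ t in a..b, f t := by
    have e1 : a + b - b = a := by ring
    have e2 : a + b - a = b := by ring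
    rw [intervalIntegral.integral_comp_sub_left (fun t => f t) (a + b), e1, e2]
  have hpt : ∀ t ∈ Icc a b, f t + f (a + b - t) ≤ f a + f b := by
    intro t ht
    rcases eq_or_lt_of_le hab with h | h
    · subst h
      have hta : t = a := le_antisymm ht.2 ht.1
      subst hta
      simp
    · have hba : 0 < b - a := sub_pos.mpr h
      have hne : b - a ≠ 0 := hba.ne'
      have ha : a ∈ Icc a b := left_mem_Icc.mpr hab
      have hb : b ∈ Icc a b := right_mem_Icc.mpr hab
      have hw1 : 0 ≤ (b - t) / (b - a) := div_nonneg (sub_nonneg.mpr ht.2) hba.le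
      have hw2 : 0 ≤ (t - a) / (b - a) := div_nonneg (sub_nonneg.mpr ht.1) hba.le
      have hsum : (b - t) / (b - a) + (t - a) / (b - a) = 1 := by
        field_simp
        ring
      have hsum' : (t - a) / (b - a) + (b - t) / (b - a) = 1 := by rw [add_comm]; exact hsum
      have h1 := hconv.2 ha hb hw1 hw2 hsum
      have h2 := hconv.2 ha hb hw2 hw1 hsum'
      have e1 : ((b - t) / (b - a)) • a + ((t - a) / (b - a)) • b = t := by
        simp only [smul_eq_mul]
        field_simp
        ring
      have e2 : ((t - a) / (b - a)) • a + ((b - t) / (b - a)) • b = a + b - t := by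
        simp only [smul_eq_mul]
        field_simp
        ring
      rw [e1] at h1
      rw [e2] at h2
      calc f t + f (a + b - t)
          ≤ (((b - t) / (b - a)) • f a + ((t - a) / (b - a)) • f b)
            + (((t - a) / (b - a)) • f a + ((b - t) / (b - a)) • f b) := add_le_add h1 h2
        _ = ((b - t) / (b - a) + (t - a) / (b - a)) * (f a + f b) := by
            simp only [smul_eq_mul]; ring
        _ = f a + f b := by rw [hsum, one_mul]
  have hfi : IntervalIntegrable f volume a b := hf.intervalIntegrable a b
  have hgi : IntervalIntegrable (fun t => f (a + b - t)) volume a b :=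
    (hf.comp (continuous_const.sub continuous_id)).intervalIntegrable a b
  have hle : (∫ t in a..b, f t + f (a + b - t)) ≤ ∫ _ in a..b, (f a + f b) :=
    intervalIntegral.integral_mono_on hab (hfi.add hgi) intervalIntegrable_const hpt
  rw [intervalIntegral.integral_add hfi hgi, hsym, hint, intervalIntegral.integral_const,
    smul_eq_mul] at hle
  linarith

/-- Concave version: `(b − a)(f a + f b)/2 ≤ Φ b − Φ a`. [folklore] -/
theorem trapezoid_le_sub_of_concaveOn {f Φ : ℝ → ℝ} {a b : ℝ} (hab : a ≤ b) (hf : Continuous f)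
    (hconc : ConcaveOn ℝ (Icc a b) f) (hΦ : ∀ t, HasDerivAt Φ (f t) t) :
    (b - a) * (f a + f b) / 2 ≤ Φ b - Φ a := by
  have h := sub_le_trapezoid_of_convexOn (f := fun t => -f t) (Φ := fun t => -Φ t) hab hf.neg
    hconc.neg (fun t => (hΦ t).neg)
  linarith

/-- Second-derivative test on a closed interval from global first and second derivatives
(Mathlib's `convexOn_of_hasDerivWithinAt2_nonneg`, repackaged). [folklore] -/
theorem convexOn_Icc_of_hasDerivAt2_nonneg {f f' f'' : ℝ → ℝ} {a b : ℝ}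
    (hf : ∀ t, HasDerivAt f (f' t) t) (hf' : ∀ t, HasDerivAt f' (f'' t) t)
    (hpos : ∀ t ∈ Icc a b, 0 ≤ f'' t) : ConvexOn ℝ (Icc a b) f :=
  convexOn_of_hasDerivWithinAt2_nonneg (convex_Icc a b)
    (fun t _ => (hf t).continuousAt.continuousWithinAt)
    (fun t _ => (hf t).hasDerivWithinAt) (fun t _ => (hf' t).hasDerivWithinAt)
    (fun t ht => hpos t (interior_subset ht))

/-- Concave twin of `convexOn_Icc_of_hasDerivAt2_nonneg`. [folklore] -/
theorem concaveOn_Icc_of_hasDerivAt2_nonpos {f f' f'' : ℝ → ℝ} {a b : ℝ}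
    (hf : ∀ t, HasDerivAt f (f' t) t) (hf' : ∀ t, HasDerivAt f' (f'' t) t)
    (hneg : ∀ t ∈ Icc a b, f'' t ≤ 0) : ConcaveOn ℝ (Icc a b) f :=
  concaveOn_of_hasDerivWithinAt2_nonpos (convex_Icc a b)
    (fun t _ => (hf t).continuousAt.continuousWithinAt)
    (fun t _ => (hf t).hasDerivWithinAt) (fun t _ => (hf' t).hasDerivWithinAt)
    (fun t ht => hneg t (interior_subset ht))

/-- **Trapezoid-rule error bound** (via Hermite–Hadamard applied to the convex `f + (M/2) t²`
and the concave `f − (M/2) t²`): if `Φ' = f`, `f'` and `f''` exist everywhere and `|f''| ≤ M` on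
`[a, b]`, then `|(b − a)(f a + f b)/2 − (Φ b − Φ a)| ≤ M (b − a)³ / 12` (the classical constant).
[folklore] -/
theorem abs_trapezoid_sub_le {f f' f'' Φ : ℝ → ℝ} {a b M : ℝ} (hab : a ≤ b)
    (hΦ : ∀ t, HasDerivAt Φ (f t) t) (hf : ∀ t, HasDerivAt f (f' t) t)
    (hf' : ∀ t, HasDerivAt f' (f'' t) t) (hM : ∀ t ∈ Icc a b, |f'' t| ≤ M) :
    |(b - a) * (f a + f b) / 2 - (Φ b - Φ a)| ≤ M * (b - a) ^ 3 / 12 := by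
  -- polynomial derivatives
  have hp1 : ∀ t : ℝ, HasDerivAt (fun t : ℝ => M * t) M t := fun t => by
    simpa using (hasDerivAt_id t).const_mul M
  have hp2 : ∀ t : ℝ, HasDerivAt (fun t : ℝ => M / 2 * t ^ 2) (M * t) t := fun t => by
    have h := ((hasDerivAt_id t).mul (hasDerivAt_id t)).const_mul (M / 2)
    simp only [id, one_mul, mul_one, ← pow_two] at h
    exact h.congr_deriv (by ring)
  have hp3 : ∀ t : ℝ, HasDerivAt (fun t : ℝ => M / 6 * t ^ 3) (M / 2 * t ^ 2) t := fun t => by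
    refine ((hasDerivAt_pow 3 t).const_mul (M / 6)).congr_deriv ?_
    simp only [Nat.cast_ofNat, show (3 - 1 : ℕ) = 2 from rfl]
    ring
  -- the convex side: g₊ = f + (M/2) t², Φ₊ = Φ + (M/6) t³
  have hgp : ∀ t, HasDerivAt (fun t => f t + M / 2 * t ^ 2) (f' t + M * t) t :=
    fun t => (hf t).add (hp2 t)
  have hgp' : ∀ t, HasDerivAt (fun t => f' t + M * t) (f'' t + M) t :=
    fun t => (hf' t).add (hp1 t)
  have hPhip : ∀ t, HasDerivAt (fun t => Φ t + M / 6 * t ^ 3) (f t + M / 2 * t ^ 2) t :=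
    fun t => (hΦ t).add (hp3 t)
  have hconv : ConvexOn ℝ (Icc a b) (fun t => f t + M / 2 * t ^ 2) :=
    convexOn_Icc_of_hasDerivAt2_nonneg hgp hgp'
      (fun t ht => by have := (abs_le.mp (hM t ht)).1; linarith)
  have hcontp : Continuous (fun t => f t + M / 2 * t ^ 2) :=
    continuous_iff_continuousAt.mpr fun t => (hgp t).continuousAt
  have hp := sub_le_trapezoid_of_convexOn hab hcontp hconv hPhip
  -- the concave side: g₋ = f − (M/2) t², Φ₋ = Φ − (M/6) t³
  have hgm : ∀ t, HasDerivAt (fun t => f t - M / 2 * t ^ 2) (f' t - M * t) t :=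
    fun t => (hf t).sub (hp2 t)
  have hgm' : ∀ t, HasDerivAt (fun t => f' t - M * t) (f'' t - M) t :=
    fun t => (hf' t).sub (hp1 t)
  have hPhim : ∀ t, HasDerivAt (fun t => Φ t - M / 6 * t ^ 3) (f t - M / 2 * t ^ 2) t :=
    fun t => (hΦ t).sub (hp3 t)
  have hconc : ConcaveOn ℝ (Icc a b) (fun t => f t - M / 2 * t ^ 2) :=
    concaveOn_Icc_of_hasDerivAt2_nonpos hgm hgm'
      (fun t ht => by have := (abs_le.mp (hM t ht)).2; linarith)
  have hcontm : Continuous (fun t => f t - M / 2 * t ^ 2) :=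
    continuous_iff_continuousAt.mpr fun t => (hgm t).continuousAt
  have hm := trapezoid_le_sub_of_concaveOn hab hcontm hconc hPhim
  rw [abs_le]
  constructor
  · linarith
  · linarith

/-! ## The trapezoid defect of one quasi-static step -/

/-- Trapezoid defect of `F` on `[a, b]`: `(b − a)(⟨D⟩_a + ⟨D⟩_b)/2 − (F b − F a)`, i.e. the
trapezoid rule for `∫_a^b ⟨D⟩_c dc` minus the integral (`linFreeEnergy_sub_eq_integral`). -/
noncomputable def trapDefect (S₀ D : X → ℝ) (a b : ℝ) : ℝ :=
  (b - a) * (meanD S₀ D a + meanD S₀ D b) / 2 - (linFreeEnergy S₀ D b - linFreeEnergy S₀ D a)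

/-- One quasi-static step = half the drop of `⟨D⟩` times the step + the trapezoid defect:
`(b − a)⟨D⟩_a − (F b − F a) = (b − a)(⟨D⟩_a − ⟨D⟩_b)/2 + defect[a, b]`. -/
theorem qsStep_eq_half_add_trapDefect (S₀ D : X → ℝ) (a b : ℝ) :
    (b - a) * meanD S₀ D a - (linFreeEnergy S₀ D b - linFreeEnergy S₀ D a)
      = (b - a) * (meanD S₀ D a - meanD S₀ D b) / 2 + trapDefect S₀ D a b := by
  unfold trapDefect
  ring

/-- Positively skewed switch observable along `[a, b]` ⇒ `⟨D⟩_c` convex there ⇒ the trapezoid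
over-estimates `∫⟨D⟩` ⇒ the defect is non-negative. -/
theorem trapDefect_nonneg_of_kappa3D_nonneg [Nonempty X] (S₀ D : X → ℝ) {a b : ℝ} (hab : a ≤ b)
    (h : ∀ c ∈ Icc a b, 0 ≤ kappa3D S₀ D c) : 0 ≤ trapDefect S₀ D a b := by
  have hconv : ConvexOn ℝ (Icc a b) (meanD S₀ D) :=
    convexOn_Icc_of_hasDerivAt2_nonneg (f' := fun c => -varD S₀ D c) (f'' := kappa3D S₀ D)
      (hasDerivAt_meanD S₀ D)
      (fun c => (hasDerivAt_varD S₀ D c).neg.congr_deriv (neg_neg _)) h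
  have := sub_le_trapezoid_of_convexOn hab (continuous_meanD S₀ D) hconv
    (hasDerivAt_linFreeEnergy S₀ D)
  unfold trapDefect
  linarith

/-- Negatively skewed ⇒ concave ⇒ non-positive defect. -/
theorem trapDefect_nonpos_of_kappa3D_nonpos [Nonempty X] (S₀ D : X → ℝ) {a b : ℝ} (hab : a ≤ b)
    (h : ∀ c ∈ Icc a b, kappa3D S₀ D c ≤ 0) : trapDefect S₀ D a b ≤ 0 := by
  have hconc : ConcaveOn ℝ (Icc a b) (meanD S₀ D) :=
    concaveOn_Icc_of_hasDerivAt2_nonpos (f' := fun c => -varD S₀ D c) (f'' := kappa3D S₀ D)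
      (hasDerivAt_meanD S₀ D)
      (fun c => (hasDerivAt_varD S₀ D c).neg.congr_deriv (neg_neg _)) h
  have := trapezoid_le_sub_of_concaveOn hab (continuous_meanD S₀ D) hconc
    (hasDerivAt_linFreeEnergy S₀ D)
  unfold trapDefect
  linarith

/-- **Defect bound.**  `|κ₃,c(D)| ≤ M` on `[a, b]` ⇒ `|defect[a, b]| ≤ M (b − a)³ / 12`. -/
theorem abs_trapDefect_le [Nonempty X] (S₀ D : X → ℝ) {a b M : ℝ} (hab : a ≤ b)
    (hM : ∀ c ∈ Icc a b, |kappa3D S₀ D c| ≤ M) :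
    |trapDefect S₀ D a b| ≤ M * (b - a) ^ 3 / 12 :=
  abs_trapezoid_sub_le (f' := fun c => -varD S₀ D c) (f'' := kappa3D S₀ D) hab
    (hasDerivAt_linFreeEnergy S₀ D) (hasDerivAt_meanD S₀ D)
    (fun c => (hasDerivAt_varD S₀ D c).neg.congr_deriv (neg_neg _)) hM

/-! ## The uniform `n`-step protocol: the floor plus the summed defects -/

/-- The `k`-th cell `[k/n, (k+1)/n]` of the uniform grid is ordered … -/
theorem div_le_succ_div (n k : ℕ) : (k : ℝ) / n ≤ ((k + 1 : ℕ) : ℝ) / n :=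
  div_le_div_of_nonneg_right (by exact_mod_cast Nat.le_succ k) (Nat.cast_nonneg n)

/-- … has width `1/n` … -/
theorem succ_div_sub_div {n : ℕ} (hn : n ≠ 0) (k : ℕ) :
    ((k + 1 : ℕ) : ℝ) / n - (k : ℝ) / n = 1 / n := by
  have hn' : (n : ℝ) ≠ 0 := Nat.cast_ne_zero.mpr hn
  rw [Nat.cast_succ]
  field_simp
  ring

/-- … and lies in `[0, 1]` when `k < n`. -/
theorem Icc_div_subset_unitInterval {n k : ℕ} (hkn : k < n) :
    Icc ((k : ℝ) / n) (((k + 1 : ℕ) : ℝ) / n) ⊆ Icc (0 : ℝ) 1 := by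
  have hn' : (0 : ℝ) < n := by exact_mod_cast lt_of_le_of_lt (Nat.zero_le k) hkn
  intro c hc
  refine ⟨le_trans (div_nonneg (Nat.cast_nonneg k) hn'.le) hc.1, le_trans hc.2 ?_⟩
  rw [div_le_one hn']
  exact_mod_cast Nat.succ_le_of_lt hkn

/-- **Trapezoid decomposition of the quasi-static cost.**  For the uniform linear protocol
`c_k = k/n` (Bonanno–Nada–Vadacchino's `c(n) = n/n_step`):
`KL_qs(n) = (⟨D⟩_0 − ⟨D⟩_1)/(2n) + Σ_{k<n} defect[k/n, (k+1)/n]`. -/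
theorem qsDissipation_uniform_eq [Nonempty X] (S₀ D : X → ℝ) {n : ℕ} (hn : n ≠ 0) :
    qsDissipation S₀ D (fun k => (k : ℝ) / n) n
      = (meanD S₀ D 0 - meanD S₀ D 1) / (2 * n)
        + ∑ k ∈ range n, trapDefect S₀ D ((k : ℝ) / n) (((k + 1 : ℕ) : ℝ) / n) := by
  have hn' : (n : ℝ) ≠ 0 := Nat.cast_ne_zero.mpr hn
  unfold qsDissipation
  have hstep : ∀ k ∈ range n,
      (((k + 1 : ℕ) : ℝ) / n - (k : ℝ) / n) * meanD S₀ D ((k : ℝ) / n)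
        - (linFreeEnergy S₀ D (((k + 1 : ℕ) : ℝ) / n) - linFreeEnergy S₀ D ((k : ℝ) / n))
      = 1 / (2 * (n : ℝ)) * (meanD S₀ D ((k : ℝ) / n) - meanD S₀ D (((k + 1 : ℕ) : ℝ) / n))
        + trapDefect S₀ D ((k : ℝ) / n) (((k + 1 : ℕ) : ℝ) / n) := by
    intro k _
    rw [qsStep_eq_half_add_trapDefect, succ_div_sub_div hn]
    field_simp
  rw [sum_congr rfl hstep, sum_add_distrib, ← mul_sum,
    sum_range_sub' (fun k => meanD S₀ D ((k : ℝ) / n)) n]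
  simp only [Nat.cast_zero, zero_div, div_self hn']
  ring

/-- **The floor is the quasi-static cost to second order.**  If `|κ₃,c(D)| ≤ M` along the path
`c ∈ [0, 1]`, then `|KL_qs(n) − (⟨D⟩_0 − ⟨D⟩_1)/(2n)| ≤ M/(12 n²)` for every `n ≥ 1`. -/
theorem abs_qsDissipation_uniform_sub_floor_le [Nonempty X] (S₀ D : X → ℝ) {n : ℕ} (hn : n ≠ 0)
    {M : ℝ} (hM : ∀ c ∈ Icc (0:ℝ) 1, |kappa3D S₀ D c| ≤ M) :
    |qsDissipation S₀ D (fun k => (k : ℝ) / n) n - (meanD S₀ D 0 - meanD S₀ D 1) / (2 * n)|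
      ≤ M / (12 * (n : ℝ) ^ 2) := by
  have hn' : (n : ℝ) ≠ 0 := Nat.cast_ne_zero.mpr hn
  rw [qsDissipation_uniform_eq S₀ D hn, add_sub_cancel_left]
  have hk : ∀ k ∈ range n,
      |trapDefect S₀ D ((k : ℝ) / n) (((k + 1 : ℕ) : ℝ) / n)| ≤ M * (1 / (n : ℝ)) ^ 3 / 12 := by
    intro k hk
    have hsub := Icc_div_subset_unitInterval (mem_range.mp hk)
    have h := abs_trapDefect_le S₀ D (div_le_succ_div n k) (fun c hc => hM c (hsub hc))
    rwa [succ_div_sub_div hn] at h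
  calc |∑ k ∈ range n, trapDefect S₀ D ((k : ℝ) / n) (((k + 1 : ℕ) : ℝ) / n)|
      ≤ ∑ k ∈ range n, |trapDefect S₀ D ((k : ℝ) / n) (((k + 1 : ℕ) : ℝ) / n)| :=
        abs_sum_le_sum_abs _ _
    _ ≤ ∑ k ∈ range n, M * (1 / (n : ℝ)) ^ 3 / 12 := sum_le_sum hk
    _ = M / (12 * (n : ℝ) ^ 2) := by
        rw [sum_const, card_range, nsmul_eq_mul]
        field_simp

/-- **The floor is a genuine lower bound for a positively skewed switch observable.**  If
`κ₃,c(D) ≥ 0` for all `c ∈ [0, 1]` (`⟨D⟩_c` convex), then `(⟨D⟩_0 − ⟨D⟩_1)/(2n) ≤ KL_qs(n)`. -/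
theorem floor_le_qsDissipation_uniform [Nonempty X] (S₀ D : X → ℝ) {n : ℕ} (hn : n ≠ 0)
    (h : ∀ c ∈ Icc (0:ℝ) 1, 0 ≤ kappa3D S₀ D c) :
    (meanD S₀ D 0 - meanD S₀ D 1) / (2 * n) ≤ qsDissipation S₀ D (fun k => (k : ℝ) / n) n := by
  rw [qsDissipation_uniform_eq S₀ D hn]
  have : 0 ≤ ∑ k ∈ range n, trapDefect S₀ D ((k : ℝ) / n) (((k + 1 : ℕ) : ℝ) / n) :=
    sum_nonneg (fun k hk => trapDefect_nonneg_of_kappa3D_nonneg S₀ D (div_le_succ_div n k)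
      (fun c hc => h c (Icc_div_subset_unitInterval (mem_range.mp hk) hc)))
  linarith

/-- Negatively skewed along the path (`⟨D⟩_c` concave) ⇒ `KL_qs(n) ≤ (⟨D⟩_0 − ⟨D⟩_1)/(2n)`. -/
theorem qsDissipation_uniform_le_floor [Nonempty X] (S₀ D : X → ℝ) {n : ℕ} (hn : n ≠ 0)
    (h : ∀ c ∈ Icc (0:ℝ) 1, kappa3D S₀ D c ≤ 0) :
    qsDissipation S₀ D (fun k => (k : ℝ) / n) n ≤ (meanD S₀ D 0 - meanD S₀ D 1) / (2 * n) := by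
  rw [qsDissipation_uniform_eq S₀ D hn]
  have : ∑ k ∈ range n, trapDefect S₀ D ((k : ℝ) / n) (((k + 1 : ℕ) : ℝ) / n) ≤ 0 :=
    sum_nonpos (fun k hk => trapDefect_nonpos_of_kappa3D_nonpos S₀ D (div_le_succ_div n k)
      (fun c hc => h c (Icc_div_subset_unitInterval (mem_range.mp hk) hc)))
  linarith

/-- **Design rule** (the form RESULTS §7(c)(iii) uses for the cell's NE/SNF rows): if the step
count makes the floor at most `ε`, i.e. `n ≥ (⟨D⟩_0 − ⟨D⟩_1)/(2ε)`, then the quasi-static cost is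
at most `ε + M/(12n²)`. -/
theorem qsDissipation_uniform_le_of_floor_le [Nonempty X] (S₀ D : X → ℝ) {n : ℕ} (hn : n ≠ 0)
    {M ε : ℝ} (hM : ∀ c ∈ Icc (0:ℝ) 1, |kappa3D S₀ D c| ≤ M)
    (hε : (meanD S₀ D 0 - meanD S₀ D 1) / (2 * n) ≤ ε) :
    qsDissipation S₀ D (fun k => (k : ℝ) / n) n ≤ ε + M / (12 * (n : ℝ) ^ 2) := by
  have h := (abs_le.mp (abs_qsDissipation_uniform_sub_floor_le S₀ D hn hM)).2
  linarith

/-- **Unconditional second-order law.**  For a switch observable bounded by `B`,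
`|KL_qs(n) − (⟨D⟩_0 − ⟨D⟩_1)/(2n)| ≤ 2 B³ / (3 n²)` for every `n ≥ 1`. -/
theorem abs_qsDissipation_uniform_sub_floor_le_of_bounded [Nonempty X] (S₀ D : X → ℝ) {n : ℕ}
    (hn : n ≠ 0) {B : ℝ} (hB : ∀ x, |D x| ≤ B) :
    |qsDissipation S₀ D (fun k => (k : ℝ) / n) n - (meanD S₀ D 0 - meanD S₀ D 1) / (2 * n)|
      ≤ 2 * B ^ 3 / (3 * (n : ℝ) ^ 2) := by
  have h := abs_qsDissipation_uniform_sub_floor_le S₀ D hn (M := 8 * B ^ 3)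
    (fun c _ => abs_kappa3D_le S₀ D hB c)
  calc _ ≤ 8 * B ^ 3 / (12 * (n : ℝ) ^ 2) := h
    _ = 2 * B ^ 3 / (3 * (n : ℝ) ^ 2) := by ring

end Summit.Ventures.LatticeQCDFlow.Exactness
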